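import Literature.NumberTheory.Automorphic.MeyerDifferenceRepresentation
import HarnessLib

/-!
# Meyer's global difference representation — proofs, I: generic spectral lemmas

Topic `NumberTheory/Automorphic`; namespace `Literature.NumberTheory.Automorphic`. Sibling PROOF file
of `MeyerDifferenceRepresentation` (definitions of `jointSpectrum`, `jointGenEigenspace`,
`algMultiplicity` after [Meyer2005, §2.3], and of Meyer's `π_±`). It collects the purely
representation-theoretic lemmas through which the named facts `Meyer.piPlus_two_dimensional`
[Meyer2005, Lemma 5.5] and `Meyer.spectralRealisation_rat` [Meyer2005, Thm. 5.11] are to be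
discharged (Step A of the proof plan recorded in the docstring of §"Plan" below):

* transport of `jointGenEigenspace`, `jointSpectrum`, `algMultiplicity` along an EQUIVARIANT linear
  map (`map_jointGenEigenspace_le`, `jointSpectrum_subset_of_injective`,
  `algMultiplicity_le_of_injective`) and their invariance under equivariant linear equivalences
  (`jointSpectrum_eq_of_equiv`, `algMultiplicity_eq_of_equiv`) — used to replace `π₋` on
  `(H₊ + H₋)/H₊` by any convenient isomorphic model;
* the two halves of a multiplicity computation: a finite-dimensional invariant subspace inside the
  joint generalised eigenspace bounds the multiplicity from BELOW
  (`le_algMultiplicity_of_le_jointGenEigenspace`), and injective linear maps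
  `W ⊓ jointGenEigenspace → kⁿ` for all finite-dimensional invariant `W` bound it from ABOVE
  (`algMultiplicity_le_of_forall_finrank_le`, `algMultiplicity_le_of_forall_exists_injective`);
  `algMultiplicity_eq_zero_iff_forall` and `not_mem_jointSpectrum_of_algMultiplicity_eq_zero`;
* for commutative `G`, the joint generalised eigenspace is `G`-invariant
  (`jointGenEigenspace_le_comap`);
* **finite order + unipotent ⇒ trivial** in characteristic `0`
  (`Module.End.apply_eq_self_of_pow_eq_one_of_mem_maxGenEigenspace`, and the invariant-subspace /
  representation forms `apply_eq_self_of_pow_eq_self_on`, `rep_apply_eq_self_of_pow_eq_self_on`):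
  the step "a vector of a finite-dimensional `C_K`-invariant subspace lying in the joint generalised
  eigenspace of an unramified character is fixed by the compact group `𝒪̂ˣ`" of the reduction of
  Thm. 5.11 to unramified vectors [Meyer2005, §5.1 "`V = lim V^S`", §5.7].

Everything here is proved; no definitions, no named facts.

## Plan (for `Meyer.spectralRealisation_rat`, `K = ℚ`; recorded for the sequel files)

A (this file). B: `C_ℚ ≅ ℝ_{>0} × Ẑˣ`, unramified Bruhat–Schwartz functions as functions of
`log |x|`, `𝒮(𝔸_ℚ^∞)^{Ẑˣ} = span{1_{rẐ}}`, `Σ(G ⊗ 1_Ẑ) = 2∑_{n≥1} G(n·)`, Poisson ⇒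
`JΣ𝔉 = Σ + Sing` [Meyer2005, (5.4)]. C: Mellin transform on `H₋^{unr}` (entire, injective,
`(λ_g f)^ = |g|^z f̂`, the operators `D_s = -t d/dt - s`, `R_s`). D: lower bound
`mult(|x|^s, π₋) ≥ ord_s Λ` from `h = Σ(G₀ ⊗ 1_Ẑ)`, `ĥ = z(z-1)Λ(z)/4π²`, `f^{(j)} = R_s^j h`.
E: upper bound by Mellin inversion of `f̂/2ζ = (|g|^z - c(g))⁻¹ · MG_g` (finite-dimensionality of
`W` makes this growth-free). F: assembly.

## References

* R. Meyer, *On a representation of the idele class group related to primes and zeros of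
  L-functions*, Duke Math. J. 127 (2005), 519–595 = arXiv:math/0311468, §2.3, §5.1, §5.7
  (Thm. 5.11) [Meyer2005].
-/

noncomputable section

namespace Literature.NumberTheory.Automorphic

/-! ### Transport along equivariant linear maps -/

section Transport

variable {k G V V' : Type*} [Field k] [Monoid G] [AddCommGroup V] [Module k V]
  [AddCommGroup V'] [Module k V']

/-- Iterating an intertwining relation: `T ∘ A = B ∘ T` gives `T ∘ Aⁿ = Bⁿ ∘ T`. [folklore] -/
theorem intertwine_pow_apply {A : Module.End k V} {B : Module.End k V'} {T : V →ₗ[k] V'}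
    (hT : ∀ v, T (A v) = B (T v)) (n : ℕ) (v : V) : T ((A ^ n) v) = (B ^ n) (T v) := by
  induction n generalizing v with
  | zero => simp
  | succ n ih =>
    rw [pow_succ, pow_succ, Module.End.mul_apply, Module.End.mul_apply, ih, hT]

variable {ρ : Representation k G V} {ρ' : Representation k G V'} {T : V →ₗ[k] V'}

/-- An equivariant `T` intertwines the powers `(ρ g - c)ⁿ` and `(ρ' g - c)ⁿ`. [folklore] -/
theorem intertwine_sub_smul_pow_apply (hT : ∀ g v, T (ρ g v) = ρ' g (T v)) (g : G) (c : k)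
    (n : ℕ) (v : V) :
    T (((ρ g - c • (1 : Module.End k V)) ^ n) v) =
      ((ρ' g - c • (1 : Module.End k V')) ^ n) (T v) :=
  intertwine_pow_apply (fun v => by simp [hT]) n v

/-- **Equivariant maps preserve joint generalised eigenspaces**: `T(V_χ) ⊆ V'_χ`.
[cite: Meyer2005, §2.3] -/
theorem map_jointGenEigenspace_le (hT : ∀ g v, T (ρ g v) = ρ' g (T v)) (χ : G → k) :
    (jointGenEigenspace ρ χ).map T ≤ jointGenEigenspace ρ' χ := by
  rintro _ ⟨v, hv, rfl⟩
  rw [SetLike.mem_coe, mem_jointGenEigenspace_iff] at hv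
  rw [mem_jointGenEigenspace_iff]
  intro g
  obtain ⟨n, hn⟩ := hv g
  exact ⟨n, by rw [← intertwine_sub_smul_pow_apply hT, hn, map_zero]⟩

/-- Pointwise form of `map_jointGenEigenspace_le`. [cite: Meyer2005, §2.3] -/
theorem mem_jointGenEigenspace_of_intertwine (hT : ∀ g v, T (ρ g v) = ρ' g (T v)) {χ : G → k}
    {v : V} (hv : v ∈ jointGenEigenspace ρ χ) : T v ∈ jointGenEigenspace ρ' χ :=
  map_jointGenEigenspace_le hT χ ⟨v, hv, rfl⟩

/-- **Injective equivariant maps are monotone on spectra**: a joint eigenvector is mapped to a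
joint eigenvector with the same character. [cite: Meyer2005, §2.3] -/
theorem jointSpectrum_subset_of_injective (hT : ∀ g v, T (ρ g v) = ρ' g (T v))
    (hinj : Function.Injective T) : jointSpectrum ρ ⊆ jointSpectrum ρ' := by
  rintro χ ⟨v, hv0, hv⟩
  refine ⟨T v, fun h => hv0 (hinj (by rw [h, map_zero])), fun g => ?_⟩
  rw [← hT, hv g, map_smul]

/-- The image of an invariant subspace under an equivariant map is invariant. [folklore] -/
theorem map_le_comap_of_intertwine (hT : ∀ g v, T (ρ g v) = ρ' g (T v)) {W : Submodule k V}
    (hW : ∀ g, W ≤ W.comap (ρ g)) (g : G) : W.map T ≤ (W.map T).comap (ρ' g) := by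
  rintro _ ⟨w, hw, rfl⟩
  rw [Submodule.mem_comap, ← hT]
  exact ⟨ρ g w, hW g hw, rfl⟩

/-- Each term of the supremum defining `algMultiplicity` is bounded by it: for a finite-dimensional
invariant `W`, `dim (W ⊓ V_χ) ≤ mult(χ, ρ)`. [cite: Meyer2005, §2.3] -/
theorem finrank_inf_jointGenEigenspace_le_algMultiplicity (ρ : Representation k G V) (χ : G → k)
    (W : Submodule k V) [hfin : FiniteDimensional k W] (hW : ∀ g, W ≤ W.comap (ρ g)) :
    (Module.finrank k ↥(W ⊓ jointGenEigenspace ρ χ) : ℕ∞) ≤ algMultiplicity ρ χ := by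
  refine le_trans ?_ (le_iSup _ W)
  refine le_trans ?_ (le_iSup _ hfin)
  exact le_iSup (fun _ : ∀ g : G, W ≤ W.comap (ρ g) =>
    (Module.finrank k ↥(W ⊓ jointGenEigenspace ρ χ) : ℕ∞)) hW

/-- **Injective equivariant maps are monotone on algebraic multiplicities**: `W ↦ T(W)` sends
finite-dimensional invariant subspaces to finite-dimensional invariant subspaces and
`T(W ⊓ V_χ) ⊆ T(W) ⊓ V'_χ`. [cite: Meyer2005, §2.3] -/
theorem algMultiplicity_le_of_injective (hT : ∀ g v, T (ρ g v) = ρ' g (T v))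
    (hinj : Function.Injective T) (χ : G → k) : algMultiplicity ρ χ ≤ algMultiplicity ρ' χ := by
  refine iSup_le fun W => iSup_le fun hfin => iSup_le fun hinv => ?_
  haveI := hfin
  have hinv' : ∀ g, W.map T ≤ (W.map T).comap (ρ' g) := map_le_comap_of_intertwine hT hinv
  have h1 : (W ⊓ jointGenEigenspace ρ χ).map T ≤ W.map T ⊓ jointGenEigenspace ρ' χ :=
    le_inf (Submodule.map_mono inf_le_left)
      ((Submodule.map_mono inf_le_right).trans (map_jointGenEigenspace_le hT χ))
  have hle : Module.finrank k ↥(W ⊓ jointGenEigenspace ρ χ) ≤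
      Module.finrank k ↥(W.map T ⊓ jointGenEigenspace ρ' χ) :=
    calc Module.finrank k ↥(W ⊓ jointGenEigenspace ρ χ)
        = Module.finrank k ↥((W ⊓ jointGenEigenspace ρ χ).map T) :=
          LinearEquiv.finrank_eq (Submodule.equivMapOfInjective T hinj _)
      _ ≤ Module.finrank k ↥(W.map T ⊓ jointGenEigenspace ρ' χ) := Submodule.finrank_mono h1
  calc (Module.finrank k ↥(W ⊓ jointGenEigenspace ρ χ) : ℕ∞)
      ≤ (Module.finrank k ↥(W.map T ⊓ jointGenEigenspace ρ' χ) : ℕ∞) := by exact_mod_cast hle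
    _ ≤ algMultiplicity ρ' χ :=
        finrank_inf_jointGenEigenspace_le_algMultiplicity ρ' χ (W.map T) hinv'

/-- **Isomorphic representations have the same spectrum.** [cite: Meyer2005, §2.3] -/
theorem jointSpectrum_eq_of_equiv (e : V ≃ₗ[k] V') (he : ∀ g v, e (ρ g v) = ρ' g (e v)) :
    jointSpectrum ρ = jointSpectrum ρ' := by
  refine Set.Subset.antisymm
    (jointSpectrum_subset_of_injective (T := e.toLinearMap) he e.injective)
    (jointSpectrum_subset_of_injective (T := e.symm.toLinearMap) (fun g v => ?_) e.symm.injective)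
  apply e.injective
  change e (e.symm (ρ' g v)) = e (ρ g (e.symm v))
  rw [he, LinearEquiv.apply_symm_apply, LinearEquiv.apply_symm_apply]

/-- **Isomorphic representations have the same algebraic multiplicities.** [cite: Meyer2005, §2.3] -/
theorem algMultiplicity_eq_of_equiv (e : V ≃ₗ[k] V') (he : ∀ g v, e (ρ g v) = ρ' g (e v))
    (χ : G → k) : algMultiplicity ρ χ = algMultiplicity ρ' χ := by
  refine le_antisymm (algMultiplicity_le_of_injective (T := e.toLinearMap) he e.injective χ)
    (algMultiplicity_le_of_injective (T := e.symm.toLinearMap) (fun g v => ?_) e.symm.injective χ)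
  apply e.injective
  change e (e.symm (ρ' g v)) = e (ρ g (e.symm v))
  rw [he, LinearEquiv.apply_symm_apply, LinearEquiv.apply_symm_apply]

end Transport

/-! ### Lower and upper bounds for the algebraic multiplicity -/

section Bounds

variable {k G V : Type*} [Field k] [Monoid G] [AddCommGroup V] [Module k V]

/-- **Lower bound**: a finite-dimensional invariant subspace `W` contained in the joint generalised
eigenspace of `χ` gives `dim W ≤ mult(χ, ρ)` (`W` has a Jordan–Hölder series with all factors
`k(χ)`). [cite: Meyer2005, §2.3] -/
theorem le_algMultiplicity_of_le_jointGenEigenspace (ρ : Representation k G V) (χ : G → k)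
    (W : Submodule k V) [FiniteDimensional k W] (hW : ∀ g, W ≤ W.comap (ρ g))
    (hle : W ≤ jointGenEigenspace ρ χ) :
    (Module.finrank k W : ℕ∞) ≤ algMultiplicity ρ χ := by
  have h := finrank_inf_jointGenEigenspace_le_algMultiplicity ρ χ W hW
  rwa [inf_of_le_left hle] at h

/-- **Upper bound**: if `dim (W ⊓ V_χ) ≤ n` for every finite-dimensional invariant `W`, then
`mult(χ, ρ) ≤ n`. [cite: Meyer2005, §2.3] -/
theorem algMultiplicity_le_of_forall_finrank_le (ρ : Representation k G V) (χ : G → k) (n : ℕ)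
    (h : ∀ W : Submodule k V, FiniteDimensional k W → (∀ g, W ≤ W.comap (ρ g)) →
      Module.finrank k ↥(W ⊓ jointGenEigenspace ρ χ) ≤ n) :
    algMultiplicity ρ χ ≤ n := by
  refine iSup_le fun W => iSup_le fun hfin => iSup_le fun hinv => ?_
  exact_mod_cast h W hfin hinv

/-- **Upper bound by injective linear maps to `kⁿ`**: if for every finite-dimensional invariant
`W` the `χ`-primary part `W ⊓ V_χ` embeds linearly into `kⁿ`, then `mult(χ, ρ) ≤ n` (the form in
which the principal-part map bounds `mult(|x|^s, π₋)` by `ord_s Λ`). [cite: Meyer2005, §2.3] -/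
theorem algMultiplicity_le_of_forall_exists_injective (ρ : Representation k G V) (χ : G → k)
    (n : ℕ)
    (h : ∀ W : Submodule k V, FiniteDimensional k W → (∀ g, W ≤ W.comap (ρ g)) →
      ∃ T : ↥(W ⊓ jointGenEigenspace ρ χ) →ₗ[k] (Fin n → k), Function.Injective T) :
    algMultiplicity ρ χ ≤ n := by
  refine algMultiplicity_le_of_forall_finrank_le ρ χ n fun W hfin hinv => ?_
  obtain ⟨T, hT⟩ := h W hfin hinv
  haveI := hfin
  calc Module.finrank k ↥(W ⊓ jointGenEigenspace ρ χ) ≤ Module.finrank k (Fin n → k) :=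
        LinearMap.finrank_le_finrank_of_injective hT
    _ = n := Module.finrank_fin_fun k

/-- `mult(χ, ρ) = 0` iff `W ⊓ V_χ = 0` for every finite-dimensional invariant `W`.
[cite: Meyer2005, §2.3] -/
theorem algMultiplicity_eq_zero_iff_forall (ρ : Representation k G V) (χ : G → k) :
    algMultiplicity ρ χ = 0 ↔ ∀ W : Submodule k V, FiniteDimensional k W →
      (∀ g, W ≤ W.comap (ρ g)) → W ⊓ jointGenEigenspace ρ χ = ⊥ := by
  constructor
  · intro h W hfin hinv
    haveI := hfin
    have hle := finrank_inf_jointGenEigenspace_le_algMultiplicity ρ χ W hinv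
    rw [h, nonpos_iff_eq_zero, Nat.cast_eq_zero] at hle
    exact Submodule.finrank_eq_zero.mp hle
  · intro h
    apply nonpos_iff_eq_zero.mp
    refine (algMultiplicity_le_of_forall_finrank_le ρ χ 0 fun W hfin hinv => ?_).trans_eq (by simp)
    rw [h W hfin hinv, finrank_bot]

/-- A character of multiplicity `0` is not in the spectrum (contrapositive of
`one_le_algMultiplicity_of_mem_jointSpectrum`). [cite: Meyer2005, §2.3] -/
theorem not_mem_jointSpectrum_of_algMultiplicity_eq_zero {ρ : Representation k G V} {χ : G → k}
    (h : algMultiplicity ρ χ = 0) : χ ∉ jointSpectrum ρ := fun hχ => by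
  have h1 := one_le_algMultiplicity_of_mem_jointSpectrum hχ
  rw [h] at h1
  exact absurd h1 (by simp)

end Bounds

/-! ### Commutative groups: invariance of the joint generalised eigenspace -/

section Comm

variable {k G V : Type*} [Field k] [CommMonoid G] [AddCommGroup V] [Module k V]

/-- For commutative `G` the operators `ρ h` preserve every joint generalised eigenspace
(`ρ h` commutes with each `ρ g`). [cite: Meyer2005, §2.3] -/
theorem jointGenEigenspace_le_comap (ρ : Representation k G V) (χ : G → k) (h : G) :
    jointGenEigenspace ρ χ ≤ (jointGenEigenspace ρ χ).comap (ρ h) := by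
  intro v hv
  rw [Submodule.mem_comap]
  simp only [jointGenEigenspace, Submodule.mem_iInf] at hv ⊢
  intro g
  have hcomm : Commute (ρ g) (ρ h) := by
    change ρ g * ρ h = ρ h * ρ g
    rw [← map_mul, ← map_mul, mul_comm]
  exact Module.End.mapsTo_maxGenEigenspace_of_comm hcomm (χ g) (hv g)

end Comm

/-! ### Finite order and unipotent implies trivial (characteristic zero) -/

section FiniteOrder

variable {k V : Type*} [Field k] [CharZero k] [AddCommGroup V] [Module k V]

omit [CharZero k] in
/-- The geometric sum `S = ∑_{i<m} Tⁱ` acts as `m` on fixed vectors. [folklore] -/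
theorem geom_sum_apply_of_apply_eq_self (T : Module.End k V) (m : ℕ) {w : V} (hw : T w = w) :
    (∑ i ∈ Finset.range m, T ^ i) w = (m : k) • w := by
  have hpow : ∀ i : ℕ, (T ^ i) w = w := by
    intro i
    induction i with
    | zero => simp
    | succ i ih => rw [pow_succ, Module.End.mul_apply, hw, ih]
  rw [LinearMap.coe_sum, Finset.sum_apply]
  simp_rw [hpow]
  rw [Finset.sum_const, Finset.card_range, ← Nat.cast_smul_eq_nsmul k]

/-- **An operator of finite order has no non-trivial unipotent part** (characteristic `0`): if
`Tᵐ = 1` with `m ≥ 1` and `(T - 1)ᴺ v = 0`, then `T v = v`. Proof: with `S = ∑_{i<m} Tⁱ`,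
`S (T - 1) = Tᵐ - 1 = 0` and `S = m` on `T`-fixed vectors; downward induction on `N`.
[folklore] -/
theorem Module.End.apply_eq_self_of_pow_eq_one_of_mem_maxGenEigenspace (T : Module.End k V)
    {m : ℕ} (hm : 0 < m) (hT : T ^ m = 1) {v : V} (hv : v ∈ T.maxGenEigenspace 1) : T v = v := by
  rw [Module.End.mem_maxGenEigenspace] at hv
  obtain ⟨N, hN⟩ := hv
  simp only [one_smul] at hN
  -- `S (T - 1) = 0`
  set S : Module.End k V := ∑ i ∈ Finset.range m, T ^ i with hS
  have hST : S * (T - 1) = 0 := by rw [hS, geom_sum_mul, hT, sub_self]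
  have hcomm : Commute S (T - 1) := by
    refine Commute.sub_right ?_ (Commute.one_right S)
    rw [hS]
    exact Commute.sum_left _ _ _ fun i _ => (Commute.refl T).pow_left i
  -- downward induction: `(T - 1) ^ (n + 1) v = 0 → (T - 1) v = 0`
  have key : ∀ n : ℕ, ((T - 1) ^ (n + 1)) v = 0 → (T - 1) v = 0 := by
    intro n
    induction n with
    | zero => intro h; simpa using h
    | succ n ih =>
      intro h
      apply ih
      -- `w := (T - 1)^(n+1) v` is fixed by `T`, and `S w = 0`, so `m • w = 0`
      set w := ((T - 1) ^ (n + 1)) v with hw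
      have hTw : T w = w := by
        have h' : (T - 1) w = 0 := by
          rw [hw, ← Module.End.mul_apply, ← pow_succ', h]
        rw [LinearMap.sub_apply, Module.End.one_apply, sub_eq_zero] at h'
        exact h'
      have hSw : S w = 0 := by
        rw [hw, pow_succ, Module.End.mul_apply, ← Module.End.mul_apply (f := S),
          (hcomm.pow_right (n := n)).eq] at *
        -- now `S w = ((T-1)^n * S) ((T - 1) v)`; use `S (T - 1) = 0`
        change ((T - 1) ^ n * S) ((T - 1) v) = 0
        rw [Module.End.mul_apply, ← Module.End.mul_apply (f := S), hST, LinearMap.zero_apply,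
          map_zero]
      have hmw : (m : k) • w = 0 := by rw [← geom_sum_apply_of_apply_eq_self T m hTw, hSw]
      have hm' : (m : k) ≠ 0 := by exact_mod_cast hm.ne'
      exact (smul_eq_zero.mp hmw).resolve_left hm'
  cases N with
  | zero =>
    -- `(T - 1)^0 v = v = 0`
    simp only [pow_zero, Module.End.one_apply] at hN
    rw [hN, map_zero]
  | succ n =>
    have h := key n hN
    rw [LinearMap.sub_apply, Module.End.one_apply, sub_eq_zero] at h
    exact h

/-- Invariant-subspace form: if `T` preserves `W`, `Tᵐ = 1` on `W` (`m ≥ 1`), `v ∈ W` and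
`(T - 1)ᴺ v = 0`, then `T v = v`. [folklore] -/
theorem apply_eq_self_of_pow_eq_self_on (T : Module.End k V) (W : Submodule k V)
    (hW : ∀ w ∈ W, T w ∈ W) {m : ℕ} (hm : 0 < m) (hTm : ∀ w ∈ W, (T ^ m) w = w) {v : V}
    (hvW : v ∈ W) (hv : v ∈ T.maxGenEigenspace 1) : T v = v := by
  set T' : Module.End k W := T.restrict hW with hT'
  have hpow : ∀ (i : ℕ) (w : W), ((T' ^ i) w : V) = (T ^ i) (w : V) := by
    intro i
    induction i with
    | zero => intro w; simp
    | succ i ih =>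
      intro w
      rw [pow_succ', pow_succ', Module.End.mul_apply, Module.End.mul_apply, ← ih]
      rfl
  have hT'm : T' ^ m = 1 := by
    refine LinearMap.ext fun w => Subtype.ext ?_
    rw [hpow, Module.End.one_apply]
    exact hTm w w.2
  have hv' : (⟨v, hvW⟩ : W) ∈ T'.maxGenEigenspace 1 := by
    rw [hT', Module.End.maxGenEigenspace, Module.End.genEigenspace_restrict]
    exact hv
  have h := Module.End.apply_eq_self_of_pow_eq_one_of_mem_maxGenEigenspace T' hm hT'm hv'
  exact congrArg Subtype.val h

variable {G : Type*} [Monoid G]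

/-- **Representation form (unramified reduction)**: let `W` be a finite-dimensional… — more
generally any — invariant subspace on which `ρ (g ^ m)` acts trivially (`m ≥ 1`), and let `χ` be a
character with `χ g = 1`. Then `ρ g` fixes every `v ∈ W ⊓ V_χ`. Applied with `g` in the image of
`𝒪̂ˣ` in `C_K` (which acts on finite-dimensional subspaces of `𝒮`-type function spaces through
finite quotients) and `χ = |x|^s`. [cite: Meyer2005, §5.1] -/
theorem rep_apply_eq_self_of_pow_eq_self_on (ρ : Representation k G V) (χ : G → k)
    (W : Submodule k V) (hW : ∀ h, W ≤ W.comap (ρ h)) (g : G) (hχ : χ g = 1) {m : ℕ}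
    (hm : 0 < m) (hgm : ∀ w ∈ W, ρ (g ^ m) w = w) {v : V}
    (hv : v ∈ W ⊓ jointGenEigenspace ρ χ) : ρ g v = v := by
  refine apply_eq_self_of_pow_eq_self_on (ρ g) W (fun w hw => hW g hw) hm
    (fun w hw => by rw [← map_pow]; exact hgm w hw) hv.1 ?_
  have h2 := (Submodule.mem_iInf _).mp hv.2 g
  rwa [hχ] at h2

end FiniteOrder

end Literature.NumberTheory.Automorphic
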